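import Literature.NumberTheory.QuadraticFields.RealQuadraticPrincipalCycle
import HarnessLib

/-!
# Shanks' distance along the principal cycle: gaps, positions and the ideal index of a real number

Topic `NumberTheory/QuadraticFields`; continues `RealQuadraticPrincipalCycle.lean`.
Theorem-and-definition file (no named facts). Along the principal cycle `x₁, x₂ = ρx₁, …` of the
non-square discriminant `D ≡ 0, 1 (mod 4)` (period `p`, regulator `R = log ε = ∑_{i<p} log φ(ρⁱx₁)`)
we set up the "circle of circumference `R`" on which the reduced principal ideals sit at their
Shanks distances (Jozsa 2003, §7–§8; Jacobson–Williams §7.4, Fig. 7.1; Lenstra 1982), unrolled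
along `[0, ∞)`:

* `gap D i = log φ(ρⁱ x₁) > 0` — the distance from the `i`-th ideal to the next
  (`δ(J_i, ρJ_i) = ln γ_i`, Jozsa Prop. 31), `p`-periodic in `i`, with `gap < log (2√D)` and
  **`log 2 < gap i + gap (i+1)`** (Jozsa Prop. 32 / JW p. 108: `φ_k φ_{k+1} = ⌊φ_k⌋φ_{k+1} + 1 > 2`);
* `pos D m = ∑_{j<m} gap j` — the position (unrolled distance) of the `m`-th ideal, strictly
  increasing, `pos (m + p) = pos m + R` (`pos_add_periodLength`), `pos (2n) ≥ n log 2`, unbounded;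
* `periodLength_le`: `p ≤ 2R/log 2 + 1` (Jozsa Prop. 30);
* `idx D x` — the index of the ideal nearest to the left of `x ≥ 0` (`pos (idx x) ≤ x < pos (idx x + 1)`,
  `idx_eq_iff`), Jozsa's `I_x` (§9) as an index, with `idx (x + R) = idx x + p`.

## References

* R. Jozsa, *Notes on Hallgren's efficient quantum algorithm for solving Pell's equation*,
  arXiv:quant-ph/0302134 (2003), §6.3 Props. 26–28, 30, §7 Props. 31–32, §8, §9 (I_x). [Jozsa2003]
* M. J. Jacobson, Jr., H. C. Williams, *Solving the Pell Equation*, Springer (2009), §5.3 (p. 108,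
  `φ_kφ_{k+1} > 2`), §7.4 (infrastructure, Fig. 7.1). [JacobsonWilliams2008]
-/

noncomputable section

open scoped Classical

namespace Literature.NumberTheory.QuadraticFields

namespace QuadIrr

variable {D : ℕ}

/-! ### Gaps -/

/-- The `i`-th gap `log φ(ρⁱ x₁)`: Shanks' distance from the `i`-th ideal of the principal cycle to
the next. [cite: Jozsa2003, §7 Prop. 31 (δ(J_i, ρ(J_i)) = ln γ_i)] -/
def gap (D : ℕ) (i : ℕ) : ℝ := Real.log ((step^[i] (principalFirst D)).val)

/-- Gaps are positive (`φ > 1`). [cite: Jozsa2003, §7 Prop. 31] -/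
theorem gap_pos (hD : ¬ IsSquare D) (hD4 : D % 4 = 0 ∨ D % 4 = 1) (i : ℕ) : 0 < gap D i :=
  Real.log_pos (isReduced_iterate hD (isReduced_principalFirst hD hD4) i).2.2.1

/-- Gaps are `p`-periodic. [cite: Jozsa2003, §6.3 Thm. 4(a)] -/
theorem gap_add_periodLength (i : ℕ) : gap D (i + periodLength D) = gap D i := by
  unfold gap periodLength
  rw [Function.iterate_add_apply, Function.iterate_minimalPeriod]

/-- Gaps are `p`-periodic (multiples). [cite: Jozsa2003, §6.3 Thm. 4(a)] -/
theorem gap_add_mul_periodLength (i l : ℕ) : gap D (i + l * periodLength D) = gap D i := by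
  induction l with
  | zero => simp
  | succ l ih => rw [Nat.succ_mul, ← Nat.add_assoc, gap_add_periodLength, ih]

/-- `φ φ' > 2` for a reduced `φ` and its step `φ' = 1/(φ − ⌊φ⌋)`: `φφ' = ⌊φ⌋φ' + 1`.
[cite: JacobsonWilliams2008, §5.3 (p. 108, φ_{k+1}φ_k = ⌊φ_k⌋φ_{k+1} + 1 > 2)] -/
theorem two_lt_val_mul_val_step (hD : ¬ IsSquare D) {x : QuadIrr D} (h : x.IsReduced) :
    2 < x.val * (step x).val := by
  have h' := isReduced_step hD h
  have hv' : 1 < (step x).val := h'.2.2.1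
  have hq : (1 : ℝ) ≤ x.pq := by exact_mod_cast h.one_le_pq
  have hfrac : x.val - x.pq ≠ 0 := sub_ne_zero.mpr ((irrational_val hD h.isAdmissible.1).ne_int _)
  have key : x.val * (step x).val = x.pq * (step x).val + 1 := by
    rw [val_step hD h.isAdmissible]; field_simp; ring
  rw [key]
  nlinarith

/-- **Two consecutive gaps exceed `log 2`.** [cite: Jozsa2003, §7 Prop. 32] -/
theorem log_two_lt_gap_add_gap_succ (hD : ¬ IsSquare D) (hD4 : D % 4 = 0 ∨ D % 4 = 1) (i : ℕ) :
    Real.log 2 < gap D i + gap D (i + 1) := by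
  have hred := isReduced_iterate hD (isReduced_principalFirst hD hD4) i
  have h1 : 0 < (step^[i] (principalFirst D)).val := by linarith [hred.2.2.1]
  have h2 : 0 < (step^[i + 1] (principalFirst D)).val := by
    linarith [(isReduced_iterate hD (isReduced_principalFirst hD hD4) (i + 1)).2.2.1]
  unfold gap
  rw [← Real.log_mul h1.ne' h2.ne']
  apply Real.log_lt_log two_pos
  rw [Function.iterate_succ_apply']
  exact two_lt_val_mul_val_step hD hred

/-- A gap is less than `log (2√D)` (`φ = (P + √D)/Q < 2√D`). [cite: Jozsa2003, §6.3 Prop. 26] -/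
theorem gap_lt (hD : ¬ IsSquare D) (hD4 : D % 4 = 0 ∨ D % 4 = 1) (i : ℕ) :
    gap D i < Real.log (2 * Real.sqrt D) := by
  have hred := isReduced_iterate hD (isReduced_principalFirst hD hD4) i
  set x := step^[i] (principalFirst D)
  have hv : 1 < x.val := hred.2.2.1
  apply Real.log_lt_log (by linarith)
  have hQ : (1 : ℝ) ≤ x.Q := by exact_mod_cast hred.1
  have hP := hred.P_lt_sqrt
  have hs := sqrt_pos hD
  unfold val
  rw [div_lt_iff₀ (by linarith)]
  nlinarith

/-! ### Positions -/

/-- The position of the `m`-th ideal: `∑_{j<m} gap j` (unrolled Shanks distance from `𝒪`).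
[cite: Jozsa2003, §7 (δ(J_i) = ln α_i) and §8] -/
def pos (D : ℕ) (m : ℕ) : ℝ := ∑ j ∈ Finset.range m, gap D j

/-- `pos 0 = 0`. [folklore] -/
@[simp] theorem pos_zero : pos D 0 = 0 := by simp [pos]

/-- `pos (m+1) = pos m + gap m`. [folklore] -/
theorem pos_succ (m : ℕ) : pos D (m + 1) = pos D m + gap D m := by
  simp [pos, Finset.sum_range_succ]

/-- Positions are strictly increasing. [cite: Jozsa2003, §8] -/
theorem pos_strictMono (hD : ¬ IsSquare D) (hD4 : D % 4 = 0 ∨ D % 4 = 1) : StrictMono (pos D) := by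
  refine strictMono_nat_of_lt_succ fun m => ?_
  rw [pos_succ]
  linarith [gap_pos hD hD4 m]

/-- Positions are monotone. [cite: Jozsa2003, §8] -/
theorem pos_mono (hD : ¬ IsSquare D) (hD4 : D % 4 = 0 ∨ D % 4 = 1) : Monotone (pos D) :=
  (pos_strictMono hD hD4).monotone

/-- Positions are nonnegative. [folklore] -/
theorem pos_nonneg (hD : ¬ IsSquare D) (hD4 : D % 4 = 0 ∨ D % 4 = 1) (m : ℕ) : 0 ≤ pos D m := by
  have := pos_mono hD hD4 (Nat.zero_le m)
  simpa using this

/-- `pos p = R = log ε`. [cite: Jozsa2003, §6.3 Thm. 4(b)] -/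
theorem pos_periodLength (hD : ¬ IsSquare D) (hD4 : D % 4 = 0 ∨ D % 4 = 1) :
    pos D (periodLength D) = Real.log (fundUnit D) := by
  rw [log_fundUnit hD hD4]; rfl

/-- **Periodicity of positions: `pos (m + p) = pos m + R`.** [cite: Jozsa2003, §8 (ideals around a circle of circumference R)] -/
theorem pos_add_periodLength (hD : ¬ IsSquare D) (hD4 : D % 4 = 0 ∨ D % 4 = 1) (m : ℕ) :
    pos D (m + periodLength D) = pos D m + Real.log (fundUnit D) := by
  induction m with
  | zero => simp [pos_periodLength hD hD4]
  | succ m ih =>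
    rw [Nat.add_right_comm, pos_succ, pos_succ, ih, gap_add_periodLength]
    ring

/-- `pos (m + lp) = pos m + lR`. [cite: Jozsa2003, §8] -/
theorem pos_add_mul_periodLength (hD : ¬ IsSquare D) (hD4 : D % 4 = 0 ∨ D % 4 = 1) (m l : ℕ) :
    pos D (m + l * periodLength D) = pos D m + l * Real.log (fundUnit D) := by
  induction l with
  | zero => simp
  | succ l ih =>
    rw [Nat.succ_mul, ← Nat.add_assoc, pos_add_periodLength hD hD4, ih]
    push_cast; ring

/-- **`pos (2n) > n log 2`** (pairs of consecutive gaps). [cite: Jozsa2003, §6.3 Prop. 28] -/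
theorem mul_log_two_le_pos (hD : ¬ IsSquare D) (hD4 : D % 4 = 0 ∨ D % 4 = 1) (n : ℕ) :
    n * Real.log 2 ≤ pos D (2 * n) := by
  induction n with
  | zero => simp
  | succ n ih =>
    rw [show 2 * (n + 1) = 2 * n + 1 + 1 by ring, pos_succ, pos_succ]
    have := log_two_lt_gap_add_gap_succ hD hD4 (2 * n)
    push_cast
    linarith

/-- Positions are unbounded. [cite: Jozsa2003, §6.3 Prop. 29 (lim α_i = ∞)] -/
theorem exists_lt_pos (hD : ¬ IsSquare D) (hD4 : D % 4 = 0 ∨ D % 4 = 1) (x : ℝ) : ∃ m, x < pos D m := by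
  obtain ⟨n, hn⟩ := exists_nat_gt (x / Real.log 2)
  refine ⟨2 * n, ?_⟩
  have h2 : 0 < Real.log 2 := Real.log_pos one_lt_two
  rw [div_lt_iff₀ h2] at hn
  exact hn.trans_le (mul_log_two_le_pos hD hD4 n)

/-- **`p ≤ 2R/log 2 + 1`** (the length of the principal cycle). [cite: Jozsa2003, §6.3 Prop. 30] -/
theorem periodLength_le (hD : ¬ IsSquare D) (hD4 : D % 4 = 0 ∨ D % 4 = 1) :
    (periodLength D : ℝ) ≤ 2 * Real.log (fundUnit D) / Real.log 2 + 1 := by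
  have h2 : 0 < Real.log 2 := Real.log_pos one_lt_two
  set p := periodLength D with hp
  have hmono := pos_mono hD hD4 (show 2 * (p / 2) ≤ p by omega)
  rw [pos_periodLength hD hD4] at hmono
  have h1 := mul_log_two_le_pos hD hD4 (p / 2)
  have h3 : ((p / 2 : ℕ) : ℝ) * Real.log 2 ≤ Real.log (fundUnit D) := h1.trans hmono
  have h4 : (p : ℝ) ≤ 2 * ((p / 2 : ℕ) : ℝ) + 1 := by
    have : p ≤ 2 * (p / 2) + 1 := by omega
    exact_mod_cast this
  rw [div_add_one h2.ne', le_div_iff₀ h2]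
  nlinarith

/-! ### The ideal to the left of `x` -/

/-- The index of the ideal nearest to the left of `x`: the least `m` with `x < pos (m + 1)`
(Jozsa's `I_x`, §9, as an index along the unrolled cycle). [cite: Jozsa2003, §9 (h(x) = (I_x, x̃ − δ(I_x)))] -/
def idx (hD : ¬ IsSquare D) (hD4 : D % 4 = 0 ∨ D % 4 = 1) (x : ℝ) : ℕ :=
  Nat.find (exists_lt_pos hD hD4 x |>.imp fun m hm => hm.trans_le (pos_mono hD hD4 (Nat.le_succ m)))

/-- `x < pos (idx x + 1)`. [cite: Jozsa2003, §9] -/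
theorem lt_pos_idx_succ (hD : ¬ IsSquare D) (hD4 : D % 4 = 0 ∨ D % 4 = 1) (x : ℝ) :
    x < pos D (idx hD hD4 x + 1) :=
  Nat.find_spec (exists_lt_pos hD hD4 x |>.imp fun m hm => hm.trans_le (pos_mono hD hD4 (Nat.le_succ m)))

/-- `pos (idx x) ≤ x` for `x ≥ 0`. [cite: Jozsa2003, §9] -/
theorem pos_idx_le (hD : ¬ IsSquare D) (hD4 : D % 4 = 0 ∨ D % 4 = 1) {x : ℝ} (hx : 0 ≤ x) :
    pos D (idx hD hD4 x) ≤ x := by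
  rcases Nat.eq_zero_or_pos (idx hD hD4 x) with h | h
  · rw [h]; simpa using hx
  · obtain ⟨m, hm⟩ := Nat.exists_eq_succ_of_ne_zero h.ne'
    rw [hm]
    have := Nat.find_min (exists_lt_pos hD hD4 x |>.imp fun m hm => hm.trans_le (pos_mono hD hD4 (Nat.le_succ m)))
      (show m < idx hD hD4 x by rw [hm]; exact Nat.lt_succ_self m)
    exact not_lt.mp this

/-- **Characterisation of the index**: `idx x = m ↔ pos m ≤ x < pos (m+1)` (`x ≥ 0`).
[cite: Jozsa2003, §9] -/
theorem idx_eq_iff (hD : ¬ IsSquare D) (hD4 : D % 4 = 0 ∨ D % 4 = 1) {x : ℝ} (hx : 0 ≤ x) (m : ℕ) :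
    idx hD hD4 x = m ↔ pos D m ≤ x ∧ x < pos D (m + 1) := by
  constructor
  · rintro rfl
    exact ⟨pos_idx_le hD hD4 hx, lt_pos_idx_succ hD hD4 x⟩
  · rintro ⟨h1, h2⟩
    have hmono := pos_strictMono hD hD4
    apply le_antisymm
    · by_contra h
      push Not at h
      have : pos D (m + 1) ≤ pos D (idx hD hD4 x) := hmono.monotone h
      linarith [pos_idx_le hD hD4 hx]
    · by_contra h
      push Not at h
      have : pos D (idx hD hD4 x + 1) ≤ pos D m := hmono.monotone h
      linarith [lt_pos_idx_succ hD hD4 x]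

/-- **Shift by the regulator**: `idx (x + lR) = idx x + lp`. [cite: Jozsa2003, §9 (h is periodic with period R)] -/
theorem idx_add_mul_log (hD : ¬ IsSquare D) (hD4 : D % 4 = 0 ∨ D % 4 = 1) {x : ℝ} (hx : 0 ≤ x) (l : ℕ) :
    idx hD hD4 (x + l * Real.log (fundUnit D)) = idx hD hD4 x + l * periodLength D := by
  have hR : 0 ≤ (l : ℝ) * Real.log (fundUnit D) := by
    have := Real.log_pos (one_lt_fundUnit hD hD4); positivity
  rw [idx_eq_iff hD hD4 (by linarith) _]
  obtain ⟨h1, h2⟩ := (idx_eq_iff hD hD4 hx _).mp rfl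
  refine ⟨?_, ?_⟩
  · rw [pos_add_mul_periodLength hD hD4]; linarith
  · rw [Nat.add_right_comm, pos_add_mul_periodLength hD hD4]; linarith

end QuadIrr

end Literature.NumberTheory.QuadraticFields

end
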